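import Mathlib

/-!
# T5StabiliserSorting — the Hodge type of every eigenline `ℓ_θ` (N1 §ID-2(a))

Prose step (route/T5-ID-p2.md v7.1, ID-2(a)): the `τ₁`-eigenspace of `H¹(A_{μ} ⊗_{τ₁} ℂ, ℂ)` for
the `F`-action is `⊕_{θ : θ|_{F₁} = id} ℓ_θ`, and each eigenline `ℓ_θ` lies in `H^{1,0}` iff
`g_θ^{-1} ∘ τ₁ ∈ Φ_μ` (B3(e′)), where `g_θ ∈ Aut(ℂ)` extends `θ`; for `θ|_{F₁} = id_{F₁}` one has
`g_θ ∈ Aut(ℂ/F₁) = Aut(ℂ/M_μ)`, which STABILISES the CM type `Φ_μ` (B2 (B2-vi):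
`Aut(ℂ/M_Φ) = {h : h ∘ Φ = Φ}`), so the condition reads `τ₁ ∈ Φ_μ` for EVERY such `θ`:
all the eigenlines of the `τ₁`-eigenspace have the same Hodge type.

The group-action triviality behind it: if `h` stabilises a subset `Φ` of a `G`-set `X`
(`h • Φ = Φ`), then `h⁻¹ • x ∈ Φ ↔ x ∈ Φ` for every `x` (here `G = Aut(ℂ)` acting on
`X = Hom(E, ℂ)` by composition, `Φ = Φ_μ`, `x = τ₁`, `h = g_θ`).
-/

namespace Summit.Ventures.HodgeRepro2.T5StabiliserSorting

open scoped Pointwise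

variable {G X : Type*} [Group G] [MulAction G X]

/-- If `h • Φ = Φ` then `h⁻¹ • x ∈ Φ ↔ x ∈ Φ`: the membership test of B3(e′) is independent of
`θ` once `g_θ` stabilises `Φ_μ`. -/
theorem inv_smul_mem_iff_of_mem_stabilizer {Φ : Set X} {h : G}
    (hh : h ∈ MulAction.stabilizer G Φ) (x : X) : h⁻¹ • x ∈ Φ ↔ x ∈ Φ := by
  rw [← Set.mem_smul_set_iff_inv_smul_mem, MulAction.mem_stabilizer_iff.mp hh]

/-- The same with `h` in place of `h⁻¹`. -/
theorem smul_mem_iff_of_mem_stabilizer {Φ : Set X} {h : G}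
    (hh : h ∈ MulAction.stabilizer G Φ) (x : X) : h • x ∈ Φ ↔ x ∈ Φ := by
  have := inv_smul_mem_iff_of_mem_stabilizer (inv_mem hh) x
  rwa [inv_inv] at this

/-- ID-2(a) in one statement: for a family `g : ι → G` of elements stabilising `Φ` (the `g_θ`,
`θ|_{F₁} = id`), the predicates `g i ⁻¹ • x ∈ Φ` («`ℓ_θ ⊂ H^{1,0}`») are all equivalent to
`x ∈ Φ` («`τ₁ ∈ Φ_μ`»): either all the eigenlines are of type `(1,0)` or all are of type `(0,1)`. -/
theorem forall_inv_smul_mem_iff {ι : Type*} {Φ : Set X} (g : ι → G)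
    (hg : ∀ i, g i ∈ MulAction.stabilizer G Φ) (x : X) :
    (∀ i, (g i)⁻¹ • x ∈ Φ) ↔ (Nonempty ι → x ∈ Φ) := by
  constructor
  · intro h ⟨i⟩
    exact (inv_smul_mem_iff_of_mem_stabilizer (hg i) x).mp (h i)
  · intro h i
    exact (inv_smul_mem_iff_of_mem_stabilizer (hg i) x).mpr (h ⟨i⟩)

/-- The stabiliser of `Φ` is the stabiliser of its complement (`Aut(ℂ/M_Φ)` also stabilises the
conjugate CM type `Φ̄`). -/
theorem mem_stabilizer_compl_iff {Φ : Set X} {h : G} :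
    h ∈ MulAction.stabilizer G Φᶜ ↔ h ∈ MulAction.stabilizer G Φ := by
  simp only [MulAction.mem_stabilizer_iff, Set.smul_set_compl, compl_inj_iff]

end Summit.Ventures.HodgeRepro2.T5StabiliserSorting
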